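import Literature.Probability.Percolation.QuadLowestCrossingProofs
import Literature.Probability.Percolation.QuadCrossingSquareModel
import HarnessLib

/-!
# Chart crossings ↔ quad crossings of the swapped perturbed quad
# (crux `SubseqCardy`, stmt-CriticalPhenomena-5768, line `registered`, lead c4; W3 part C)

Route `CardyAnchoredRigidity` (decl shared verbatim with `CardyLocalRigidity`), sub-problem
`CardyFormulaZ2`. Work package W3 of this line is the general self-duality `g R + g R⁺ = 1` of joint
sequential limits `g` of the bond crossing probabilities (`R⁺` = the conformal rectangle with the
marks shifted by one). Its mesh-level half is proved with the chart machinery of Schramm–Smirnov's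
Lemma 6.1 (`QuadLowestCrossingProofs.lean`), which speaks the CHART form of the crossing event,
while the joint-limit dictionary speaks the PATH form on perturbed quads
(`QuadCrossingSquareModel.lean`). This file is the dictionary between the two:

* chart form `SSContinuity.ChartCrossed G a b c d δ ω`: some continuum `K` of the chart rectangle
  `[a,b] ×ℂ [c,d]`, drawn by `G` into the open edges of `ω` at mesh `δ`, meets the vertical sides
  `re = a` and `re = b`;
* path form `ω ∈ quadCrossing (perturbQuad Ψ x₀ x₁ y₀ y₁ hx hy) δ`: some point of arc `0`
  (`= Ψ`(bottom side of `[x₀,x₁] × [y₀,y₁]`)) is joined to a point of arc `2` (`= Ψ`(top side)) by a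
  path inside (the closed quad `Ψ([x₀,x₁] × [y₀,y₁])`) ∩ (the open edges).

With `Ψ = swapC.trans G` (`swapC` = swap of the chart coordinates, so `Ψ z = G (swapC z)` and
`Ψ.symm z = swapC (G.symm z)`), `x₀ = c`, `x₁ = d`, `y₀ = a`, `y₁ = b`: the bottom/top sides of
`Ψ`'s rectangle `[c,d] × [a,b]` are the left/right sides of `G`'s rectangle `[a,b] × [c,d]`, and the
closed quad is `G([a,b] ×ℂ [c,d])` (`SelfDualChartBridge.mem_closure_carrier_iff`,
`SelfDualChartBridge.mem_arc_zero_iff`, `SelfDualChartBridge.mem_arc_two_iff`). The two forms then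
agree (`chartCrossed_iff_mem_quadCrossing_perturbQuad`):

* `→`: the drawn continuum `G '' K` is compact, connected, inside the open edges and inside the
  closed quad, so its two side points are joined by a PATH inside (closed quad ∩ open edges) —
  Schramm–Smirnov's "in the discrete setting there is no difference between connected and
  path-connected crossings" (`joinedIn_inter_openEdgeUnion_of_isConnected`, which needs `δ > 0`);
* `←`: the pulled-back range `G.symm '' range γ` of a crossing path `γ` is a continuum of the
  chart rectangle drawn into the open edges and containing the pull-backs of the endpoints, whose
  real parts are `a` and `b`.

Pure bookkeeping over proved tree facts; no named-fact hypotheses, no new definitions.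

References: O. Schramm, S. Smirnov, *On the scaling limits of planar percolation*, Ann. Probab. 39
(2011) 1768–1814, arXiv:1101.5820, §1.3 (quads, crossings; connected = path-connected crossings in
the discrete setting) and proof of Lemma 5.1 (the perturbations `Q^q`). [SchrammSmirnov2011]
-/

noncomputable section

open Set Complex
open Literature.Probability.LatticeModels
open Literature.Probability.Percolation
open Literature.Probability.Percolation.SSContinuity

namespace Summit.CriticalPhenomena.CardyFormulaZ2.Cruxes.SubseqCardy.Birth

namespace SelfDualChartBridge

/-- The inverse of the swapped chart `swapC.trans G` is `swapC ∘ G.symm` (`swapC` is an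
involution). [folklore] -/
theorem symm_swapC_trans_apply (G : ℂ ≃ₜ ℂ) (z : ℂ) :
    (swapC.trans G).symm z = swapC (G.symm z) := rfl

/-- Real part in the swapped chart = imaginary part in the chart. [folklore] -/
theorem re_symm_swapC_trans (G : ℂ ≃ₜ ℂ) (z : ℂ) :
    ((swapC.trans G).symm z).re = (G.symm z).im := rfl

/-- Imaginary part in the swapped chart = real part in the chart. [folklore] -/
theorem im_symm_swapC_trans (G : ℂ ≃ₜ ℂ) (z : ℂ) :
    ((swapC.trans G).symm z).im = (G.symm z).re := rfl

/-- The closed swapped perturbed quad `(swapC.trans G)([c,d] × [a,b])` is `G([a,b] ×ℂ [c,d])`: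
membership read through `G.symm`. [folklore] -/
theorem mem_closure_carrier_iff (G : ℂ ≃ₜ ℂ) {a b c d : ℝ} (hab : a < b) (hcd : c < d) (z : ℂ) :
    z ∈ closure (perturbQuad (swapC.trans G) c d a b hcd hab).carrier ↔
      G.symm z ∈ Icc a b ×ℂ Icc c d := by
  rw [mem_closure_perturbQuad_carrier hcd hab (swapC.trans G), re_symm_swapC_trans,
    im_symm_swapC_trans, mem_reProdIm, and_comm]

/-- Arc `0` of the swapped perturbed quad `(swapC.trans G)([c,d] × [a,b])` is the `G`-image of the
left side `re = a` of `[a,b] × [c,d]`. [folklore] -/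
theorem mem_arc_zero_iff (G : ℂ ≃ₜ ℂ) {a b c d : ℝ} (hab : a < b) (hcd : c < d) (z : ℂ) :
    z ∈ (perturbQuad (swapC.trans G) c d a b hcd hab).arc 0 ↔
      (G.symm z).re = a ∧ (G.symm z).im ∈ Icc c d := by
  rw [mem_perturbQuad_arc_zero hcd hab (swapC.trans G), re_symm_swapC_trans, im_symm_swapC_trans]

/-- Arc `2` of the swapped perturbed quad `(swapC.trans G)([c,d] × [a,b])` is the `G`-image of the
right side `re = b` of `[a,b] × [c,d]`. [folklore] -/
theorem mem_arc_two_iff (G : ℂ ≃ₜ ℂ) {a b c d : ℝ} (hab : a < b) (hcd : c < d) (z : ℂ) :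
    z ∈ (perturbQuad (swapC.trans G) c d a b hcd hab).arc 2 ↔
      (G.symm z).re = b ∧ (G.symm z).im ∈ Icc c d := by
  rw [mem_perturbQuad_arc_two hcd hab (swapC.trans G), re_symm_swapC_trans, im_symm_swapC_trans]

end SelfDualChartBridge

open SelfDualChartBridge

/-- **Chart form ↔ path form of the crossing event** (W3 part C of crux `SubseqCardy`,
stmt-CriticalPhenomena-5768, line `registered`, lead c4). For a chart `G : ℂ ≃ₜ ℂ`, a rectangle
`[a,b] × [c,d]` (`a < b`, `c < d`) and a mesh `δ > 0`: the chart rectangle is crossed through `G`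
(`ChartCrossed`: a continuum of `[a,b] ×ℂ [c,d]` drawn by `G` into the open edges meets `re = a` and
`re = b`) iff the perturbed quad `(swapC.trans G)([c,d] × [a,b])` — the same plane set
`G([a,b] × [c,d])` with arc `0` = `G`(left side), arc `2` = `G`(right side) — is crossed in the
sense of `quadCrossing` (a point of arc `0` joined to a point of arc `2` by a path inside the closed
quad ∩ the open edges). `→` is Schramm–Smirnov's "in the discrete setting there is no difference
between connected and path-connected crossings" (`joinedIn_inter_openEdgeUnion_of_isConnected`)
applied to the drawn continuum `G '' K`; `←` pulls the range of the crossing path back by `G.symm`.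
[cite: SchrammSmirnov2011, §1.3] -/
theorem chartCrossed_iff_mem_quadCrossing_perturbQuad : ∀ (G : ℂ ≃ₜ ℂ) (a b c d : ℝ) (hab : a < b) (hcd : c < d) (δ : ℝ), 0 < δ → ∀ ω : Literature.Probability.Percolation.BondConfig (Literature.Probability.LatticeModels.Site 2), Literature.Probability.Percolation.SSContinuity.ChartCrossed G a b c d δ ω ↔ ω ∈ Literature.Probability.Percolation.quadCrossing (Literature.Probability.Percolation.perturbQuad (Literature.Probability.Percolation.SSContinuity.swapC.trans G) c d a b hcd hab) δ := by
  intro G a b c d hab hcd δ hδ ω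
  constructor
  · rintro ⟨K, hKsub, hKc, hKconn, hKO, ⟨ua, hua, huare⟩, ⟨ub, hub, hubre⟩⟩
    -- the drawn continuum `G '' K` lies in the open edges and in the closed quad
    have hKO' : G '' K ⊆ openEdgeUnion δ ω := by
      rintro _ ⟨u, hu, rfl⟩
      exact hKO u hu
    have hKC : G '' K ⊆ closure (perturbQuad (swapC.trans G) c d a b hcd hab).carrier := by
      rintro _ ⟨u, hu, rfl⟩
      rw [mem_closure_carrier_iff, Homeomorph.symm_apply_apply]
      exact hKsub hu
    refine ⟨G ua, ?_, G ub, ?_,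
      joinedIn_inter_openEdgeUnion_of_isConnected hδ (hKc.image G.continuous)
        (hKconn.image _ G.continuous.continuousOn) hKO' hKC (mem_image_of_mem G hua)
        (mem_image_of_mem G hub)⟩
    · rw [mem_arc_zero_iff, Homeomorph.symm_apply_apply]
      exact ⟨huare, (mem_reProdIm.1 (hKsub hua)).2⟩
    · rw [mem_arc_two_iff, Homeomorph.symm_apply_apply]
      exact ⟨hubre, (mem_reProdIm.1 (hKsub hub)).2⟩
  · rintro ⟨p, hp, q, hq, γ, hγ⟩
    rw [mem_arc_zero_iff] at hp
    rw [mem_arc_two_iff] at hq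
    -- the pulled-back range of the crossing path is a chart crossing
    refine ⟨G.symm '' range γ, ?_, (isCompact_range γ.continuous).image G.symm.continuous,
      (isConnected_range γ.continuous).image _ G.symm.continuous.continuousOn, ?_, ?_, ?_⟩
    · rintro _ ⟨_, ⟨t, rfl⟩, rfl⟩
      exact (mem_closure_carrier_iff G hab hcd _).1 (hγ t).1
    · rintro _ ⟨_, ⟨t, rfl⟩, rfl⟩
      rw [Homeomorph.apply_symm_apply]
      exact (hγ t).2
    · exact ⟨G.symm p, ⟨p, ⟨0, γ.source⟩, rfl⟩, hp.1⟩
    · exact ⟨G.symm q, ⟨q, ⟨1, γ.target⟩, rfl⟩, hq.1⟩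

end Summit.CriticalPhenomena.CardyFormulaZ2.Cruxes.SubseqCardy.Birth

end
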